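import Summits.QuantumFields.YangMills.Theorems.FluctuationComparisonRegPrIntLS2BetaRelativeLadderVarTwoSquare
import HarnessLib

/-!
# S2β · THE SUP CHAIN, the one-profile lift recursion's SOURCE `ρ̃` (architect ruling 19:37:59Z: «(d) `ρ̃`, critical path, px12»): the relative plaquette of
# `W̃ := A_W·A_U⁻¹·U` against `W` is AT MOST the relative plaquette of the two STAGE fields plus the relative plaquette of the two LIFTS plus mixed commutator
# prices `O(arc × relative chord)` — exact group algebra, any `GaugeGroup`

Cell `ym3-torus` (YM ladder rung R3 = continuum `SU(2)` Yang–Mills on the three-torus at fixed lattice data — a RUNG: NOT d = 4, NOT infinite volume, NOT a mass gap,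
NOT Clay).  Width seat «width 12» `ym3-torus-px12` (gen 26), FREE px helper on crux `stmt-QuantumFields-20520`; LINE g18-1 S2β, sup chain (UV3-NODE §94.5, §102.10):
LIFT-LADDER″ is ONE-PROFILE — every bond's chord is `η = Ad(R)·ε`, `ε` an intra-block ladder of relative plaquettes of the pair `(W̃, W)` (px21 g24 ✓p832278
`dist1_eps_le_of_intraBlock … (hρ : ∀ q, blockOf q.src = B → dist1 ((plaqHol W̃ q)⁻¹ * plaqHol W q) ≤ ρ̃)`, `W̃ := fun b => A_W b * ((A_U b)⁻¹ * U b)`).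
THIS FILE bounds that `ρ̃` by the two sources the budget knows.  `--kind proof --supports stmt-QuantumFields-20520 --as helper`, count-neutral, DEFINITION-FREE.

THE IDENTITY.  For bond values `Tᵢ, Uᵢ` around a plaquette (word `F₁F₂F₃⁻¹F₄⁻¹`), `□(T·U) = Ω·□U` with `Ω := T₁·(U₁T₂U₁⁻¹)·(gT₃⁻¹g⁻¹)·(□U·T₄⁻¹·□U⁻¹)`, `g := U₁U₂U₃⁻¹`
(EXACT, `group`); and `Ω·(□T)⁻¹` is a triple of conjugation defects, each `≤ 2·dist1(conjugator)·dist1(T)` under the commutator letter `hcomm` (✓`dist1_comm_le` on `SU(2)`).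
Applied twice — to `W̃ = T·U` with `T := A_W·A_U⁻¹`, and to `A_W = T·A_U` — it gives
  `dist1 ((□W̃)⁻¹·□W) ≤ dist1 ((□U)⁻¹·□W) + dist1 (□A_W·(□A_U)⁻¹) + 2·Σ(dist1 of U-conjugators + A_U-conjugators)·(max relative-lift chord)`
— the relative plaquette of the STAGE pair (source `ρ`), the relative plaquette of the LIFTS (my g23 ✓`…WhitneyHatLiftCurvatureRelative.dist1_rect_rel_lift_sq_le`:
`L⁻²`×(coarse relative plaquette + variation) in sup form), and MIXED prices (absolute arcs × relative lift chord — the `O(s·M)` column); NOTHING absolute-squared.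

WHAT IS PROVED (sorry-free; [folklore] group algebra over the `GaugeGroup` axioms `dist1_mul_le`∕`dist1_conj`∕`dist1_inv`).
§1 `plaq_mul_eq_omega_mul_plaq` (the identity), `dist1_omega_mul_plaq_inv_le` (the three conjugation defects, via ✓`dist1_triple_telescope`), ★`dist1_plaq_mul_le`
   (`dist1 (□(T·U)·(□T·□U)⁻¹)`-type bound), ★★`dist1_plaq_rel_tilde_le` (THE LETTER for eight group elements + the two lifts' four: the displayed inequality).
§2 ★★★`dist1_plaqHol_tilde_rel_le` — the `GaugeField` edition at a plaquette `p` with `W̃` spelled EXACTLY as in ✓p832278 (`fun b => A_W b * ((A_U b)⁻¹ * U b)`), sizes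
   as hypotheses: `dist1 (U b) ≤ s`, `dist1 (A_U b) ≤ τ`, `dist1 ((A_U b)⁻¹ * A_W b) ≤ m` on the four bonds of `p`, `dist1 (plaqHol U p) ≤ θ` ⟹
   **`dist1 ((plaqHol W̃ p)⁻¹ * plaqHol W p) ≤ dist1 ((plaqHol U p)⁻¹ * plaqHol W p) + dist1 (plaqHol A_W p * (plaqHol A_U p)⁻¹) + 2·(4s + θ)·m + 2·(4τ + θ_A)·m`**
   (`θ_A` a bound on `dist1 (plaqHol A_U p)`).

HONEST SCOPE.  Identities and triangle inequalities; nothing of Bałaban's renormalisation-group analysis is asserted or proved ([Balaban1985Averaging] (8)–(9) p.19, (58) p.27;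
[Balaban1985RegularSpaces] (1.19), (1.29) pp.79–81 — the printed gauge∕lift conventions); the sizes `s, τ, m, θ, θ_A`, the lifts' relative plaquette letter, the ladder
letter ✓p832278, NC-ROW′∕COMB-ROW′'s per-`B` assembly (px5), the source budget (px13∕px16), (RSP), (ST′)∕(ST″)∕(ST), LOC, GAP♯∘ (`stub_uniformFibreGapOrbit`, registry 3732b7df
UNTOUCHED), the five registered stubs (0∕5), S2β, 20520, 19936, 19200, `YM3TorusSU2` are NOT proved; no registered stub is closed; rung R3 — NOT d = 4, NOT infinite volume,
NOT a mass gap, NOT Clay; the Yang–Mills mass gap is NOT proved.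
-/

set_option autoImplicit false

namespace Summit.QuantumFields.YangMills.Theorems.FluctuationComparisonRegPrIntLS2BetaTildePlaquetteComparison

open Literature.MathematicalPhysics.QuantumFieldTheory.Balaban1983to89
open Summit.QuantumFields.YangMills.Theorems.FluctuationComparisonRegPrIntLS2BetaRelativeLadderVarTwoSquare (dist1_triple_telescope)

/-! ## §1 Group algebra: the plaquette of a bondwise product -/

section Group

variable {G : Type*} [GaugeGroup G]

/-- **THE PLAQUETTE OF A BONDWISE PRODUCT**: `□(T·U) = Ω·□U`, `Ω := T₁·(U₁T₂U₁⁻¹)·(gT₃⁻¹g⁻¹)·(□U·T₄⁻¹·(□U)⁻¹)`, `g := U₁U₂U₃⁻¹`, `□F := F₁F₂F₃⁻¹F₄⁻¹`. [folklore] -/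
theorem plaq_mul_eq_omega_mul_plaq (T₁ T₂ T₃ T₄ U₁ U₂ U₃ U₄ : G) :
    (T₁ * U₁) * (T₂ * U₂) * (T₃ * U₃)⁻¹ * (T₄ * U₄)⁻¹ =
      (T₁ * (U₁ * T₂ * U₁⁻¹) * ((U₁ * U₂ * U₃⁻¹) * T₃⁻¹ * (U₁ * U₂ * U₃⁻¹)⁻¹) *
        ((U₁ * U₂ * U₃⁻¹ * U₄⁻¹) * T₄⁻¹ * (U₁ * U₂ * U₃⁻¹ * U₄⁻¹)⁻¹)) * (U₁ * U₂ * U₃⁻¹ * U₄⁻¹) := by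
  group

/-- **THE THREE CONJUGATION DEFECTS**: under the commutator letter `hcomm`, `dist1 (Ω·(□T)⁻¹) ≤ 2·(dist1 U₁·dist1 T₂ + dist1 g·dist1 T₃ + dist1 □U·dist1 T₄)`
(✓`dist1_triple_telescope` after peeling `T₁`; `dist1 (xTx⁻¹·T⁻¹) ≤ 2·dist1 x·dist1 T`, inverses free). [folklore] -/
theorem dist1_omega_mul_plaq_inv_le (hcomm : ∀ g h : G, dist1 (g * h * g⁻¹ * h⁻¹) ≤ 2 * dist1 g * dist1 h) (T₁ T₂ T₃ T₄ U₁ U₂ U₃ U₄ : G) :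
    dist1 ((T₁ * (U₁ * T₂ * U₁⁻¹) * ((U₁ * U₂ * U₃⁻¹) * T₃⁻¹ * (U₁ * U₂ * U₃⁻¹)⁻¹) *
        ((U₁ * U₂ * U₃⁻¹ * U₄⁻¹) * T₄⁻¹ * (U₁ * U₂ * U₃⁻¹ * U₄⁻¹)⁻¹)) * (T₁ * T₂ * T₃⁻¹ * T₄⁻¹)⁻¹) ≤
      2 * dist1 U₁ * dist1 T₂ + 2 * dist1 (U₁ * U₂ * U₃⁻¹) * dist1 T₃ + 2 * dist1 (U₁ * U₂ * U₃⁻¹ * U₄⁻¹) * dist1 T₄ := by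
  set g := U₁ * U₂ * U₃⁻¹ with hg
  set q := U₁ * U₂ * U₃⁻¹ * U₄⁻¹ with hq
  -- peel `T₁` by conjugation invariance
  have e : (T₁ * (U₁ * T₂ * U₁⁻¹) * (g * T₃⁻¹ * g⁻¹) * (q * T₄⁻¹ * q⁻¹)) * (T₁ * T₂ * T₃⁻¹ * T₄⁻¹)⁻¹ =
      T₁ * ((U₁ * T₂ * U₁⁻¹) * (g * T₃⁻¹ * g⁻¹) * (q * T₄⁻¹ * q⁻¹) * (T₂ * T₃⁻¹ * T₄⁻¹)⁻¹) * T₁⁻¹ := by group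
  rw [e, GaugeGroup.dist1_conj]
  have h := dist1_triple_telescope T₂ T₃⁻¹ T₄⁻¹ (U₁ * T₂ * U₁⁻¹) (g * T₃⁻¹ * g⁻¹) (q * T₄⁻¹ * q⁻¹)
  have h2 : dist1 (U₁ * T₂ * U₁⁻¹ * T₂⁻¹) ≤ 2 * dist1 U₁ * dist1 T₂ := hcomm U₁ T₂
  have h3 : dist1 (g * T₃⁻¹ * g⁻¹ * T₃⁻¹⁻¹) ≤ 2 * dist1 g * dist1 T₃ := by
    have := hcomm g T₃⁻¹; rwa [GaugeGroup.dist1_inv T₃] at this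
  have h4 : dist1 (q * T₄⁻¹ * q⁻¹ * T₄⁻¹⁻¹) ≤ 2 * dist1 q * dist1 T₄ := by
    have := hcomm q T₄⁻¹; rwa [GaugeGroup.dist1_inv T₄] at this
  linarith

/-- ★ **THE PLAQUETTE OF `T·U` AGAINST `□T·□U`**: `dist1 (□(T·U)·(□U)⁻¹·(□T)⁻¹) ≤` the three conjugation defects. [folklore] -/
theorem dist1_plaq_mul_le (hcomm : ∀ g h : G, dist1 (g * h * g⁻¹ * h⁻¹) ≤ 2 * dist1 g * dist1 h) (T₁ T₂ T₃ T₄ U₁ U₂ U₃ U₄ : G) :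
    dist1 (((T₁ * U₁) * (T₂ * U₂) * (T₃ * U₃)⁻¹ * (T₄ * U₄)⁻¹) * (U₁ * U₂ * U₃⁻¹ * U₄⁻¹)⁻¹ * (T₁ * T₂ * T₃⁻¹ * T₄⁻¹)⁻¹) ≤
      2 * dist1 U₁ * dist1 T₂ + 2 * dist1 (U₁ * U₂ * U₃⁻¹) * dist1 T₃ + 2 * dist1 (U₁ * U₂ * U₃⁻¹ * U₄⁻¹) * dist1 T₄ := by
  rw [plaq_mul_eq_omega_mul_plaq, mul_inv_cancel_right]
  exact dist1_omega_mul_plaq_inv_le hcomm T₁ T₂ T₃ T₄ U₁ U₂ U₃ U₄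

set_option maxHeartbeats 400000 in
/-- ★★ **THE `W̃`-PLAQUETTE AGAINST THE `W`-PLAQUETTE** (eight stage bond values `Uᵢ, Wᵢ`, eight lift bond values `Aᵢ := A_U`, `A′ᵢ := A_W`; `W̃ᵢ := A′ᵢ·Aᵢ⁻¹·Uᵢ`):
`dist1 ((□W̃)⁻¹·□W) ≤ dist1 ((□U)⁻¹·□W) + dist1 (□A′·(□A)⁻¹) + [U-defects of T] + [A-defects of T]`, `Tᵢ := A′ᵢAᵢ⁻¹` (the relative lift read on the left).
[cite: Balaban1985Averaging, (8)-(9) p.19; Balaban1985RegularSpaces, (1.29) p.81] -/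
theorem dist1_plaq_rel_tilde_le (hcomm : ∀ g h : G, dist1 (g * h * g⁻¹ * h⁻¹) ≤ 2 * dist1 g * dist1 h)
    (U₁ U₂ U₃ U₄ W₁ W₂ W₃ W₄ A₁ A₂ A₃ A₄ A'₁ A'₂ A'₃ A'₄ : G) :
    dist1 (((A'₁ * (A₁⁻¹ * U₁)) * (A'₂ * (A₂⁻¹ * U₂)) * (A'₃ * (A₃⁻¹ * U₃))⁻¹ * (A'₄ * (A₄⁻¹ * U₄))⁻¹)⁻¹ *
        (W₁ * W₂ * W₃⁻¹ * W₄⁻¹)) ≤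
      dist1 ((U₁ * U₂ * U₃⁻¹ * U₄⁻¹)⁻¹ * (W₁ * W₂ * W₃⁻¹ * W₄⁻¹)) +
      dist1 ((A'₁ * A'₂ * A'₃⁻¹ * A'₄⁻¹) * (A₁ * A₂ * A₃⁻¹ * A₄⁻¹)⁻¹) +
      (2 * dist1 U₁ * dist1 (A'₂ * A₂⁻¹) + 2 * dist1 (U₁ * U₂ * U₃⁻¹) * dist1 (A'₃ * A₃⁻¹) +
        2 * dist1 (U₁ * U₂ * U₃⁻¹ * U₄⁻¹) * dist1 (A'₄ * A₄⁻¹)) +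
      (2 * dist1 A₁ * dist1 (A'₂ * A₂⁻¹) + 2 * dist1 (A₁ * A₂ * A₃⁻¹) * dist1 (A'₃ * A₃⁻¹) +
        2 * dist1 (A₁ * A₂ * A₃⁻¹ * A₄⁻¹) * dist1 (A'₄ * A₄⁻¹)) := by
  -- names
  set T₁ := A'₁ * A₁⁻¹ with hT₁
  set T₂ := A'₂ * A₂⁻¹ with hT₂
  set T₃ := A'₃ * A₃⁻¹ with hT₃
  set T₄ := A'₄ * A₄⁻¹ with hT₄
  set PU := U₁ * U₂ * U₃⁻¹ * U₄⁻¹ with hPU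
  set PW := W₁ * W₂ * W₃⁻¹ * W₄⁻¹ with hPW
  set PA := A₁ * A₂ * A₃⁻¹ * A₄⁻¹ with hPA
  set PA' := A'₁ * A'₂ * A'₃⁻¹ * A'₄⁻¹ with hPA'
  set PT := T₁ * T₂ * T₃⁻¹ * T₄⁻¹ with hPT
  set PWt := (T₁ * U₁) * (T₂ * U₂) * (T₃ * U₃)⁻¹ * (T₄ * U₄)⁻¹ with hPWt
  -- `W̃ᵢ = Tᵢ·Uᵢ`
  have eW : (A'₁ * (A₁⁻¹ * U₁)) * (A'₂ * (A₂⁻¹ * U₂)) * (A'₃ * (A₃⁻¹ * U₃))⁻¹ * (A'₄ * (A₄⁻¹ * U₄))⁻¹ = PWt := by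
    rw [hPWt, hT₁, hT₂, hT₃, hT₄]; group
  rw [eW]
  -- the two product defects
  have dU : dist1 (PWt * PU⁻¹ * PT⁻¹) ≤ 2 * dist1 U₁ * dist1 T₂ + 2 * dist1 (U₁ * U₂ * U₃⁻¹) * dist1 T₃ + 2 * dist1 PU * dist1 T₄ := by
    rw [hPWt, hPU, hPT]; exact dist1_plaq_mul_le hcomm T₁ T₂ T₃ T₄ U₁ U₂ U₃ U₄
  have dA : dist1 (PA' * PA⁻¹ * PT⁻¹) ≤ 2 * dist1 A₁ * dist1 T₂ + 2 * dist1 (A₁ * A₂ * A₃⁻¹) * dist1 T₃ + 2 * dist1 PA * dist1 T₄ := by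
    have eA : PA' = (T₁ * A₁) * (T₂ * A₂) * (T₃ * A₃)⁻¹ * (T₄ * A₄)⁻¹ := by
      rw [hPA', hT₁, hT₂, hT₃, hT₄]; group
    rw [eA, hPA, hPT]; exact dist1_plaq_mul_le hcomm T₁ T₂ T₃ T₄ A₁ A₂ A₃ A₄
  -- assemble: `PWt = X·PT·PU`, `PT = Y⁻¹·PA'·PA⁻¹` (`X := PWt·PU⁻¹·PT⁻¹`, `Y := PA'·PA⁻¹·PT⁻¹`), so
  -- `PWt⁻¹·PW = PU⁻¹·[(PA·PA'⁻¹)·Y·X⁻¹]·PU·(PU⁻¹·PW)`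
  have e : PWt⁻¹ * PW = PU⁻¹ * ((PA * PA'⁻¹) * (PA' * PA⁻¹ * PT⁻¹) * (PWt * PU⁻¹ * PT⁻¹)⁻¹) * PU * (PU⁻¹ * PW) := by group
  rw [e]
  have h1 := GaugeGroup.dist1_mul_le (PU⁻¹ * ((PA * PA'⁻¹) * (PA' * PA⁻¹ * PT⁻¹) * (PWt * PU⁻¹ * PT⁻¹)⁻¹) * PU) (PU⁻¹ * PW)
  have h2 : dist1 (PU⁻¹ * ((PA * PA'⁻¹) * (PA' * PA⁻¹ * PT⁻¹) * (PWt * PU⁻¹ * PT⁻¹)⁻¹) * PU) =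
      dist1 ((PA * PA'⁻¹) * (PA' * PA⁻¹ * PT⁻¹) * (PWt * PU⁻¹ * PT⁻¹)⁻¹) := by
    have := GaugeGroup.dist1_conj ((PA * PA'⁻¹) * (PA' * PA⁻¹ * PT⁻¹) * (PWt * PU⁻¹ * PT⁻¹)⁻¹) PU⁻¹
    rwa [inv_inv] at this
  have h3 := GaugeGroup.dist1_mul_le ((PA * PA'⁻¹) * (PA' * PA⁻¹ * PT⁻¹)) (PWt * PU⁻¹ * PT⁻¹)⁻¹
  have h4 := GaugeGroup.dist1_mul_le (PA * PA'⁻¹) (PA' * PA⁻¹ * PT⁻¹)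
  have h5 : dist1 (PA * PA'⁻¹) = dist1 (PA' * PA⁻¹) := by
    rw [← GaugeGroup.dist1_inv (PA * PA'⁻¹), mul_inv_rev, inv_inv]
  rw [GaugeGroup.dist1_inv] at h3
  linarith

end Group

/-! ## §2 The `GaugeField` edition at one plaquette, `W̃` spelled as in ✓p832278 -/

section Field

variable {P : Params} {j : ℕ} {G : Type*} [GaugeGroup G]

set_option maxHeartbeats 400000 in
/-- ★★★ **THE `ρ̃` LETTER, PER PLAQUETTE**: for stage fields `U, W`, their lifts `A_U, A_W`, and `W̃ := fun b => A_W b * ((A_U b)⁻¹ * U b)` (✓p832278's spelling),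
with `dist1 (U b) ≤ s`, `dist1 (A_U b) ≤ τ`, `dist1 ((A_U b)⁻¹ * A_W b) ≤ m` on the four bonds of `p`, `dist1 (plaqHol U p) ≤ θ`, `dist1 (plaqHol A_U p) ≤ θA` (all `≥ 0`):
`dist1 ((plaqHol W̃ p)⁻¹·plaqHol W p) ≤ dist1 ((plaqHol U p)⁻¹·plaqHol W p) + dist1 (plaqHol A_W p·(plaqHol A_U p)⁻¹) + 2·(4s + θ)·m + 2·(4τ + θA)·m` — the relative
plaquette of the STAGE pair, the relative plaquette of the LIFTS (my g23's ✓`dist1_rect_rel_lift_sq_le` supplies it from the coarse level), and MIXED prices only.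
[cite: Balaban1985Averaging, (8)-(9) p.19, (58) p.27; Balaban1985RegularSpaces, (1.29) p.81] -/
theorem dist1_plaqHol_tilde_rel_le (hcomm : ∀ g h : G, dist1 (g * h * g⁻¹ * h⁻¹) ≤ 2 * dist1 g * dist1 h)
    (U W A_U A_W : GaugeField P j G) (p : Plaq P j) {s τ m θ θA : ℝ} (hs0 : 0 ≤ s) (hτ0 : 0 ≤ τ) (hm0 : 0 ≤ m)
    (hs : ∀ b : PBond P j, b = ⟨p.src, p.μ⟩ ∨ b = ⟨p.src.shift p.μ, p.ν⟩ ∨ b = ⟨p.src.shift p.ν, p.μ⟩ ∨ b = ⟨p.src, p.ν⟩ → dist1 (U b) ≤ s)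
    (hτ : ∀ b : PBond P j, b = ⟨p.src, p.μ⟩ ∨ b = ⟨p.src.shift p.μ, p.ν⟩ ∨ b = ⟨p.src.shift p.ν, p.μ⟩ ∨ b = ⟨p.src, p.ν⟩ → dist1 (A_U b) ≤ τ)
    (hm : ∀ b : PBond P j, b = ⟨p.src, p.μ⟩ ∨ b = ⟨p.src.shift p.μ, p.ν⟩ ∨ b = ⟨p.src.shift p.ν, p.μ⟩ ∨ b = ⟨p.src, p.ν⟩ → dist1 ((A_U b)⁻¹ * A_W b) ≤ m)
    (hθ : dist1 (GaugeField.plaqHol U p) ≤ θ) (hθA : dist1 (GaugeField.plaqHol A_U p) ≤ θA) :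
    dist1 ((GaugeField.plaqHol (fun b => A_W b * ((A_U b)⁻¹ * U b)) p)⁻¹ * GaugeField.plaqHol W p) ≤
      dist1 ((GaugeField.plaqHol U p)⁻¹ * GaugeField.plaqHol W p) + dist1 (GaugeField.plaqHol A_W p * (GaugeField.plaqHol A_U p)⁻¹) +
        2 * (4 * s + θ) * m + 2 * (4 * τ + θA) * m := by
  have key := dist1_plaq_rel_tilde_le hcomm (U ⟨p.src, p.μ⟩) (U ⟨p.src.shift p.μ, p.ν⟩) (U ⟨p.src.shift p.ν, p.μ⟩) (U ⟨p.src, p.ν⟩)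
    (W ⟨p.src, p.μ⟩) (W ⟨p.src.shift p.μ, p.ν⟩) (W ⟨p.src.shift p.ν, p.μ⟩) (W ⟨p.src, p.ν⟩)
    (A_U ⟨p.src, p.μ⟩) (A_U ⟨p.src.shift p.μ, p.ν⟩) (A_U ⟨p.src.shift p.ν, p.μ⟩) (A_U ⟨p.src, p.ν⟩)
    (A_W ⟨p.src, p.μ⟩) (A_W ⟨p.src.shift p.μ, p.ν⟩) (A_W ⟨p.src.shift p.ν, p.μ⟩) (A_W ⟨p.src, p.ν⟩)
  -- relative lift chords read on the left: `dist1 (A′A⁻¹) = dist1 (A⁻¹A′)`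
  have hT : ∀ b, dist1 (A_W b * (A_U b)⁻¹) = dist1 ((A_U b)⁻¹ * A_W b) := fun b => by
    have e : A_W b * (A_U b)⁻¹ = A_U b * ((A_U b)⁻¹ * A_W b) * (A_U b)⁻¹ := by group
    rw [e, GaugeGroup.dist1_conj]
  have hb1 : dist1 (U ⟨p.src, p.μ⟩) ≤ s := hs _ (Or.inl rfl)
  have hb2 : dist1 (U ⟨p.src.shift p.μ, p.ν⟩) ≤ s := hs _ (Or.inr (Or.inl rfl))
  have hb3 : dist1 (U ⟨p.src.shift p.ν, p.μ⟩) ≤ s := hs _ (Or.inr (Or.inr (Or.inl rfl)))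
  have hb4 : dist1 (U ⟨p.src, p.ν⟩) ≤ s := hs _ (Or.inr (Or.inr (Or.inr rfl)))
  have ha1 : dist1 (A_U ⟨p.src, p.μ⟩) ≤ τ := hτ _ (Or.inl rfl)
  have ha2 : dist1 (A_U ⟨p.src.shift p.μ, p.ν⟩) ≤ τ := hτ _ (Or.inr (Or.inl rfl))
  have ha3 : dist1 (A_U ⟨p.src.shift p.ν, p.μ⟩) ≤ τ := hτ _ (Or.inr (Or.inr (Or.inl rfl)))
  have hm2 : dist1 (A_W ⟨p.src.shift p.μ, p.ν⟩ * (A_U ⟨p.src.shift p.μ, p.ν⟩)⁻¹) ≤ m := by rw [hT]; exact hm _ (Or.inr (Or.inl rfl))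
  have hm3 : dist1 (A_W ⟨p.src.shift p.ν, p.μ⟩ * (A_U ⟨p.src.shift p.ν, p.μ⟩)⁻¹) ≤ m := by rw [hT]; exact hm _ (Or.inr (Or.inr (Or.inl rfl)))
  have hm4 : dist1 (A_W ⟨p.src, p.ν⟩ * (A_U ⟨p.src, p.ν⟩)⁻¹) ≤ m := by rw [hT]; exact hm _ (Or.inr (Or.inr (Or.inr rfl)))
  -- products of bonds
  have hg : dist1 (U ⟨p.src, p.μ⟩ * U ⟨p.src.shift p.μ, p.ν⟩ * (U ⟨p.src.shift p.ν, p.μ⟩)⁻¹) ≤ 3 * s := by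
    have := GaugeGroup.dist1_mul_le (U ⟨p.src, p.μ⟩ * U ⟨p.src.shift p.μ, p.ν⟩) (U ⟨p.src.shift p.ν, p.μ⟩)⁻¹
    have := GaugeGroup.dist1_mul_le (U ⟨p.src, p.μ⟩) (U ⟨p.src.shift p.μ, p.ν⟩)
    rw [GaugeGroup.dist1_inv] at *
    linarith
  have hgA : dist1 (A_U ⟨p.src, p.μ⟩ * A_U ⟨p.src.shift p.μ, p.ν⟩ * (A_U ⟨p.src.shift p.ν, p.μ⟩)⁻¹) ≤ 3 * τ := by
    have := GaugeGroup.dist1_mul_le (A_U ⟨p.src, p.μ⟩ * A_U ⟨p.src.shift p.μ, p.ν⟩) (A_U ⟨p.src.shift p.ν, p.μ⟩)⁻¹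
    have := GaugeGroup.dist1_mul_le (A_U ⟨p.src, p.μ⟩) (A_U ⟨p.src.shift p.μ, p.ν⟩)
    rw [GaugeGroup.dist1_inv] at *
    linarith
  have hPU : dist1 (U ⟨p.src, p.μ⟩ * U ⟨p.src.shift p.μ, p.ν⟩ * (U ⟨p.src.shift p.ν, p.μ⟩)⁻¹ * (U ⟨p.src, p.ν⟩)⁻¹) ≤ θ := hθ
  have hPA : dist1 (A_U ⟨p.src, p.μ⟩ * A_U ⟨p.src.shift p.μ, p.ν⟩ * (A_U ⟨p.src.shift p.ν, p.μ⟩)⁻¹ * (A_U ⟨p.src, p.ν⟩)⁻¹) ≤ θA := hθA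
  have hθ0 : 0 ≤ θ := (GaugeGroup.dist1_nonneg _).trans hθ
  have hθA0 : 0 ≤ θA := (GaugeGroup.dist1_nonneg _).trans hθA
  -- bound the six mixed products
  have p1 : 2 * dist1 (U ⟨p.src, p.μ⟩) * dist1 (A_W ⟨p.src.shift p.μ, p.ν⟩ * (A_U ⟨p.src.shift p.μ, p.ν⟩)⁻¹) ≤ 2 * s * m := by
    nlinarith [GaugeGroup.dist1_nonneg (U ⟨p.src, p.μ⟩), GaugeGroup.dist1_nonneg (A_W ⟨p.src.shift p.μ, p.ν⟩ * (A_U ⟨p.src.shift p.μ, p.ν⟩)⁻¹)]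
  have p2 : 2 * dist1 (U ⟨p.src, p.μ⟩ * U ⟨p.src.shift p.μ, p.ν⟩ * (U ⟨p.src.shift p.ν, p.μ⟩)⁻¹) * dist1 (A_W ⟨p.src.shift p.ν, p.μ⟩ * (A_U ⟨p.src.shift p.ν, p.μ⟩)⁻¹) ≤ 2 * (3 * s) * m := by
    nlinarith [GaugeGroup.dist1_nonneg (U ⟨p.src, p.μ⟩ * U ⟨p.src.shift p.μ, p.ν⟩ * (U ⟨p.src.shift p.ν, p.μ⟩)⁻¹), GaugeGroup.dist1_nonneg (A_W ⟨p.src.shift p.ν, p.μ⟩ * (A_U ⟨p.src.shift p.ν, p.μ⟩)⁻¹)]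
  have p3 : 2 * dist1 (U ⟨p.src, p.μ⟩ * U ⟨p.src.shift p.μ, p.ν⟩ * (U ⟨p.src.shift p.ν, p.μ⟩)⁻¹ * (U ⟨p.src, p.ν⟩)⁻¹) * dist1 (A_W ⟨p.src, p.ν⟩ * (A_U ⟨p.src, p.ν⟩)⁻¹) ≤ 2 * θ * m := by
    nlinarith [GaugeGroup.dist1_nonneg (U ⟨p.src, p.μ⟩ * U ⟨p.src.shift p.μ, p.ν⟩ * (U ⟨p.src.shift p.ν, p.μ⟩)⁻¹ * (U ⟨p.src, p.ν⟩)⁻¹), GaugeGroup.dist1_nonneg (A_W ⟨p.src, p.ν⟩ * (A_U ⟨p.src, p.ν⟩)⁻¹)]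
  have q1 : 2 * dist1 (A_U ⟨p.src, p.μ⟩) * dist1 (A_W ⟨p.src.shift p.μ, p.ν⟩ * (A_U ⟨p.src.shift p.μ, p.ν⟩)⁻¹) ≤ 2 * τ * m := by
    nlinarith [GaugeGroup.dist1_nonneg (A_U ⟨p.src, p.μ⟩), GaugeGroup.dist1_nonneg (A_W ⟨p.src.shift p.μ, p.ν⟩ * (A_U ⟨p.src.shift p.μ, p.ν⟩)⁻¹)]
  have q2 : 2 * dist1 (A_U ⟨p.src, p.μ⟩ * A_U ⟨p.src.shift p.μ, p.ν⟩ * (A_U ⟨p.src.shift p.ν, p.μ⟩)⁻¹) * dist1 (A_W ⟨p.src.shift p.ν, p.μ⟩ * (A_U ⟨p.src.shift p.ν, p.μ⟩)⁻¹) ≤ 2 * (3 * τ) * m := by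
    nlinarith [GaugeGroup.dist1_nonneg (A_U ⟨p.src, p.μ⟩ * A_U ⟨p.src.shift p.μ, p.ν⟩ * (A_U ⟨p.src.shift p.ν, p.μ⟩)⁻¹), GaugeGroup.dist1_nonneg (A_W ⟨p.src.shift p.ν, p.μ⟩ * (A_U ⟨p.src.shift p.ν, p.μ⟩)⁻¹)]
  have q3 : 2 * dist1 (A_U ⟨p.src, p.μ⟩ * A_U ⟨p.src.shift p.μ, p.ν⟩ * (A_U ⟨p.src.shift p.ν, p.μ⟩)⁻¹ * (A_U ⟨p.src, p.ν⟩)⁻¹) * dist1 (A_W ⟨p.src, p.ν⟩ * (A_U ⟨p.src, p.ν⟩)⁻¹) ≤ 2 * θA * m := by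
    nlinarith [GaugeGroup.dist1_nonneg (A_U ⟨p.src, p.μ⟩ * A_U ⟨p.src.shift p.μ, p.ν⟩ * (A_U ⟨p.src.shift p.ν, p.μ⟩)⁻¹ * (A_U ⟨p.src, p.ν⟩)⁻¹), GaugeGroup.dist1_nonneg (A_W ⟨p.src, p.ν⟩ * (A_U ⟨p.src, p.ν⟩)⁻¹)]
  have hfin : dist1 ((GaugeField.plaqHol (fun b => A_W b * ((A_U b)⁻¹ * U b)) p)⁻¹ * GaugeField.plaqHol W p) ≤
      dist1 ((GaugeField.plaqHol U p)⁻¹ * GaugeField.plaqHol W p) + dist1 (GaugeField.plaqHol A_W p * (GaugeField.plaqHol A_U p)⁻¹) +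
        (2 * s * m + 2 * (3 * s) * m + 2 * θ * m) + (2 * τ * m + 2 * (3 * τ) * m + 2 * θA * m) := by
    unfold GaugeField.plaqHol
    linarith [key, p1, p2, p3, q1, q2, q3]
  linarith

end Field

end Summit.QuantumFields.YangMills.Theorems.FluctuationComparisonRegPrIntLS2BetaTildePlaquetteComparison
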